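import Summits.Ventures.HodgeRepro2.T5BergmanCoefficientLpNorm

/-!
# Rühl's measure on `H_j = U(1,1)`: `μ_{U,R} = mulHom_*(haarCircle ⊗ μ_R)`

The `U(1,1)` statements of the lane carry the normalisation constant
`c_U = haarScalarFactor (map mulHom (haarCircle ⊗ μ_R)) μ_U` of the product formula of `T5U11Product`.
Taking for `μ_U` the image measure itself, `ruhlU := map mulHom (haarCircle ⊗ μ_R)` — a Haar measure
of `U(1,1)` (`instIsHaarMeasureRuhlU`), the natural extension of Rühl's normalisation `μ_R` of the Haar
measure of `SU(1,1)` by the probability measure of the centre — the constant is `1`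
(`haarScalarFactor_ruhlU`) and the bookkeeping disappears: for an integrable `F` on `U(1,1)` invariant
under the centre, `∫_{U(1,1)} F dμ_{U,R} = ∫_{SU(1,1)} F(incl h) dμ_R(h)` (`integral_ruhlU_eq`). Hence,
CONSTANT-FREE on `U(1,1)`: the Schur relation `∫ |⟨π_k(g) f, h⟩_k|² dμ_{U,R} = ⟨f,f⟩_k ⟨h,h⟩_k/(k-1)`
(`integral_norm_matrixCoeffU_sq_ruhlU`: formal degree `k - 1` against `μ_{U,R}`), the `L^p` norms of
the lowest-weight coefficient `∫ |⟨π_k(g) 1, 1⟩_k|^p dμ_{U,R} = (π/(k-1))^p · 2/(k p - 2)`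
(`integral_norm_matrixCoeffU_lowest_lowest_rpow_ruhlU`) and its `L¹` norm `2π/((k-1)(k-2))` for `k ≥ 3`
(`integral_norm_matrixCoeffU_lowest_lowest_ruhlU`); every other Haar measure is `μ_U = c⁻¹ μ_{U,R}`
(`ruhlU_eq_smul`). Nothing is claimed about (N).

Blind lane: Mathlib + the HodgeRepro2 prefix only; no sorry; axioms ⊆ {propext, Classical.choice,
Quot.sound}.
-/

namespace Summit.Ventures.HodgeRepro2.T5U11RuhlMeasure

open MeasureTheory MeasureTheory.Measure Metric Filter Topology Set
open T5PoincareDensity T5PoincareMeasure T5SU11Unimodular T5U11Unimodular T5U11Product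
  T5SU11Fibration T5SU11FibrationHaar T5HaarCircle T5SU11CoefficientL2
open T5BergmanCoefficient T5BergmanPairing T5BergmanFourier T5BergmanParseval T5BergmanProjection
  T5BergmanActStable T5BergmanMatrixCoeff T5BergmanSchur T5BergmanSchurGeneral
  T5BergmanKTypeMatrix T5BergmanIntegrableCoeff T5BergmanIntegrableSharp T5BergmanU11
  T5BergmanSchurGeneralU11 T5BergmanIntegrableKFinite T5BergmanCoefficientLp
  T5BergmanIntegrableSharpU11 T5BergmanCoefficientLpNorm
open scoped Real ENNReal NNReal

/-! ### Invariance of the coefficients under the centre -/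

/-- `|⟨π_k(λ g) f, h⟩_k| = |⟨π_k(g) f, h⟩_k|` on `U(1,1)`. -/
lemma norm_matrixCoeffU_scalarHom_mul (k : ℕ) (f h : ℂ → ℂ) (lam : Circle) (g : U11) :
    ‖matrixCoeffU k f h (scalarHom lam * g)‖ = ‖matrixCoeffU k f h g‖ :=
  (pow_left_inj₀ (norm_nonneg _) (norm_nonneg _) two_ne_zero).mp
    (norm_matrixCoeffU_sq_scalarHom_mul k f h lam g)

variable [MeasurableSpace Circle] [BorelSpace Circle] [MeasurableSpace U11] [BorelSpace U11]

/-! ### The measure -/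

/-- **Rühl's measure on `U(1,1)`**: `μ_{U,R} = mulHom_*(haarCircle ⊗ μ_R)`, the image of the product of
the probability Haar measure of the centre and Rühl's measure of `SU(1,1)`. -/
noncomputable def ruhlU : Measure U11 := map mulHom (haarCircle.prod ruhl)

/-- `μ_{U,R}` is a Haar measure of `U(1,1)`. -/
instance instIsHaarMeasureRuhlU : IsHaarMeasure ruhlU :=
  isHaarMeasure_map_mulHom haarCircle ruhl

/-- The normalisation constant of the product formula is `1` for `μ_{U,R}`. -/
theorem haarScalarFactor_ruhlU :
    haarScalarFactor (map mulHom (haarCircle.prod ruhl)) ruhlU = 1 :=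
  haarScalarFactor_self _

/-- Every Haar measure `μ_U` of `U(1,1)` is a positive multiple of `μ_{U,R}`:
`μ_{U,R} = haarScalarFactor μ_{U,R} μ_U • μ_U`. -/
theorem ruhlU_eq_smul (μU : Measure U11) [IsHaarMeasure μU] :
    ruhlU = haarScalarFactor ruhlU μU • μU :=
  map_mulHom_prod_eq_smul haarCircle ruhl μU

/-! ### Integration against `μ_{U,R}` -/

/-- **The integral formula**: for an integrable `F : U(1,1) → E` invariant under the centre,
`∫_{U(1,1)} F dμ_{U,R} = ∫_{SU(1,1)} F (incl h) dμ_R(h)`. -/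
theorem integral_ruhlU_eq {E : Type*} [NormedAddCommGroup E] [NormedSpace ℝ E] [CompleteSpace E]
    (F : U11 → E) (hF : Integrable F ruhlU)
    (hinv : ∀ (lam : Circle) (g : U11), F (scalarHom lam * g) = F g) :
    ∫ g, F g ∂ruhlU = ∫ h, F (incl h) ∂ruhl := by
  have h := integral_eq_of_scalar_invariant haarCircle ruhl ruhlU F hF hinv
  rwa [haarScalarFactor_ruhlU, NNReal.coe_one, one_smul, haarCircle_univ, ENNReal.toReal_one,
    one_smul] at h

/-- **The transfer principle for `μ_{U,R}`**: a continuous `F` on `U(1,1)` with `F (λ g) = G g` is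
`μ_{U,R}`-integrable iff `G` is `μ_R`-integrable. -/
theorem integrable_ruhlU_iff {E : Type*} [NormedAddCommGroup E] {F : U11 → E} (hF : Continuous F)
    {G : SU11 → E} (hFG : ∀ (lam : Circle) (g : SU11), F (mulHom (lam, g)) = G g) :
    Integrable F ruhlU ↔ Integrable G ruhl :=
  integrable_iff_of_mulHom ruhlU ruhl hF hFG

/-! ### The coefficients of `π_k` against `μ_{U,R}` -/

/-- **The Schur relation on `U(1,1)` against `μ_{U,R}`, constant-free**: for holomorphic
`f, h ∈ A_k`, `k ≥ 2`, `∫_{U(1,1)} |⟨π_k(g) f, h⟩_k|² dμ_{U,R} = ⟨f,f⟩_k ⟨h,h⟩_k / (k - 1)` — the formal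
degree of `π_k` against `μ_{U,R}` is `k - 1`, as against `μ_R`. -/
theorem integral_norm_matrixCoeffU_sq_ruhlU (k : ℕ) (hk : 2 ≤ k) (f h : ℂ → ℂ)
    (hf : DifferentiableOn ℂ f (ball 0 1))
    (hfint : IntegrableOn (fun w => ‖f w‖ ^ 2 * (1 - ‖w‖ ^ 2) ^ (k - 2)) (ball (0 : ℂ) 1))
    (hh : DifferentiableOn ℂ h (ball 0 1))
    (hhint : IntegrableOn (fun w => ‖h w‖ ^ 2 * (1 - ‖w‖ ^ 2) ^ (k - 2)) (ball (0 : ℂ) 1)) :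
    ∫ g, ‖matrixCoeffU k f h g‖ ^ 2 ∂ruhlU =
      (pairing k f f).re * (pairing k h h).re / ((k : ℝ) - 1) := by
  rw [integral_ruhlU_eq _ (integrable_norm_matrixCoeffU_sq ruhlU k hk f h hf hfint hh hhint)
    (norm_matrixCoeffU_sq_scalarHom_mul k f h)]
  simp_rw [matrixCoeffU_incl]
  exact schur k hk f h hf hfint hh hhint

/-- **The `L^p` norm of the lowest-weight coefficient on `U(1,1)` against `μ_{U,R}`**: for `k ≥ 2`,
`k p > 2`, `∫_{U(1,1)} |⟨π_k(g) 1, 1⟩_k|^p dμ_{U,R} = (π/(k-1))^p · 2/(k p - 2)`. -/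
theorem integral_norm_matrixCoeffU_lowest_lowest_rpow_ruhlU (k : ℕ) (hk : 2 ≤ k) {p : ℝ}
    (hp : 0 < p) (hkp : 2 < (k : ℝ) * p) :
    ∫ g, ‖matrixCoeffU k lowest lowest g‖ ^ p ∂ruhlU =
      (π / ((k : ℝ) - 1)) ^ p * (2 / ((k : ℝ) * p - 2)) := by
  have hint : Integrable (fun g => ‖matrixCoeffU k lowest lowest g‖ ^ p) ruhlU := by
    have hU := continuous_matrixCoeffU_of_differentiableOn k hk lowest (differentiableOn_const 1)
      (integrableOn_lowest k) lowest (differentiableOn_const 1) (integrableOn_lowest k)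
    exact (memLp_ofReal_iff_integrable_norm_rpow hU.aestronglyMeasurable hp).mp
      ((memLp_matrixCoeffU_lowest_lowest_iff ruhlU k hk hp).mpr hkp)
  rw [integral_ruhlU_eq _ hint (norm_matrixCoeffU_rpow_scalarHom_mul k lowest lowest p)]
  simp_rw [matrixCoeffU_incl]
  exact integral_norm_matrixCoeff_lowest_lowest_rpow_ruhl k hk hkp

/-- **The `L¹` norm of the lowest-weight coefficient on `U(1,1)` against `μ_{U,R}`** for the integrable
members `k ≥ 3`: `∫_{U(1,1)} |⟨π_k(g) 1, 1⟩_k| dμ_{U,R} = 2π / ((k-1)(k-2))`. -/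
theorem integral_norm_matrixCoeffU_lowest_lowest_ruhlU (k : ℕ) (hk : 3 ≤ k) :
    ∫ g, ‖matrixCoeffU k lowest lowest g‖ ∂ruhlU = 2 * π / (((k : ℝ) - 1) * ((k : ℝ) - 2)) := by
  have hk2 : 2 ≤ k := by omega
  have hint : Integrable (fun g => ‖matrixCoeffU k lowest lowest g‖) ruhlU :=
    ((integrable_matrixCoeffU_lowest_lowest_iff ruhlU k hk2).mpr hk).norm
  rw [integral_ruhlU_eq _ hint (norm_matrixCoeffU_scalarHom_mul k lowest lowest)]
  simp_rw [matrixCoeffU_incl]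
  exact integral_norm_matrixCoeff_lowest_lowest_ruhl k hk

/-- The Schur relation for the lowest-weight vector against `μ_{U,R}`:
`∫_{U(1,1)} |⟨π_k(g) 1, 1⟩_k|² dμ_{U,R} = (π/(k-1))² / (k-1)`. -/
theorem integral_norm_matrixCoeffU_lowest_lowest_sq_ruhlU (k : ℕ) (hk : 2 ≤ k) :
    ∫ g, ‖matrixCoeffU k lowest lowest g‖ ^ 2 ∂ruhlU = (π / ((k : ℝ) - 1)) ^ 2 / ((k : ℝ) - 1) := by
  have hk2 : (2 : ℝ) ≤ k := by exact_mod_cast hk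
  have h := integral_norm_matrixCoeffU_lowest_lowest_rpow_ruhlU k hk (p := 2) two_pos (by linarith)
  simp only [Real.rpow_two] at h
  rw [h]
  have hk1 : ((k : ℝ) - 1) ≠ 0 := by linarith
  have hk2' : ((k : ℝ) * 2 - 2) ≠ 0 := by linarith
  field_simp

end Summit.Ventures.HodgeRepro2.T5U11RuhlMeasure
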